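import Summits.NavierStokesRegularity.NavierStokesRegularity.Theorems.EulerZoomLiouvillePowerGaugeEulerLiouvilleEnergySaturationPressure
import Summits.NavierStokesRegularity.NavierStokesRegularity.Theorems.EulerZoomLiouvillePowerGaugeEulerLiouvilleEnergySaturationIdentity

/-!
# Energy saturation on rung C1 of the crux `EulerZoomLiouville.PowerGaugeEulerLiouville`, VI:
# the flux weight through the tail supremum and the TAIL ESTIMATE for the normalised energy
# (crux = stmt-NavierStokesRegularity-19832, route №10 `EulerZoomLiouville`, line `birth`)

Seat `ns-ezl-19832-w2` (stub-worker under the crux lead `ns-ezl-19832-p1`), cell ns-regularity-ideate.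

With the cut-off `σ` of `exists_radialCutoff`, the normalised energy `N_σ(L) = L^{2ρ−1}∫σ(L⁻¹y)|V|²` of a
profile obeying the lead's local energy EQUALITY satisfies the scale identity
`N_σ(L₂) − N_σ(L₁) = ∫_{L₁}^{L₂} (2+ρ) r^{2ρ−2} F_σ(r) dr` (file II).  This file bounds the integrand:

* `continuousAt_fluxWeight` — the flux weight `r ↦ (2+ρ) r^{2ρ−2} F_σ(r)` is continuous on `(0,∞)`
  (it is the continuous scale derivative of `N_σ`);
* `exists_fluxWeight_le_of_sup` — **the flux weight through the tail supremum**: there is `A ≥ 0`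
  (depending on `ρ, c, σ` only) such that whenever `N_σ ≤ S` on `[L, ∞)` (`L ≥ 1`, `0 ≤ S ≤ 3c`),
  `|(2+ρ) r^{2ρ−2} F_σ(r)| ≤ A · S^{1/2} · r^{−1−(2+ρ)/4}` for every `r ≥ L`
  (files I, IV, V: `|F_σ(r)| ≤ (M/r)∫_{r≤|y|≤2r}(|V|³ + 2|P||V|)`, and both the cubic and the
  pressure–velocity mass on `B_{8r}` are `≲ S^{1/2} r^{(6−9ρ)/4}`; `2ρ−3+(6−9ρ)/4 = −1−(2+ρ)/4`);
* `abs_normEnergy_sub_le_of_sup` — **the tail estimate**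
  `|N_σ(L₂) − N_σ(L₁)| ≤ (4A/(2+ρ)) · S^{1/2} · L₁^{−(2+ρ)/4}` for `L ≤ L₁ ≤ L₂`.

The square root of `S` on the right is the whole point: in the sequel the tail supremum absorbs itself
(`S ≤ B S^{1/2} L^{−a}` forces `S ≤ B² L^{−2a}`), which yields the Bronzi–Shvydkoy dichotomy in the weak
class.  WHAT THIS IS NOT: not NS regularity, not the crux, not rung C1 — estimates serving the
energy-saturation stratum; `--supports` stmt-19832. [folklore]
-/

noncomputable section

set_option linter.dupNamespace false

open MeasureTheory Set Filter Topology Metric Function TopologicalSpace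
open scoped ENNReal NNReal RealInnerProductSpace ContDiff Laplacian

namespace Summit.NavierStokesRegularity.NavierStokesRegularity.Theorems.PowerGaugeEulerLiouville

open Literature.Analysis Literature.Analysis.FunctionSpaces Literature.Analysis.FluidPDE

namespace EnergySaturation

variable {ρ : ℝ} {σ : EuclideanSpace ℝ (Fin 3) → ℝ}
  {V : EuclideanSpace ℝ (Fin 3) → EuclideanSpace ℝ (Fin 3)} {P : EuclideanSpace ℝ (Fin 3) → ℝ}
  {G : EuclideanSpace ℝ (Fin 3) → EuclideanSpace ℝ (Fin 3) →L[ℝ] EuclideanSpace ℝ (Fin 3)}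

/-! ## Continuity of the flux weight -/

/-- **The flux weight is continuous on `(0, ∞)`.**  Under the local energy equality at every rescaled
cut-off, `r ↦ (2+ρ) r^{2ρ−2} F_σ(r)` coincides on `(0,∞)` with the scale derivative of `N_σ`, which is
`(2ρ−1)r^{2ρ−2}∫σ_r|V|² + r^{2ρ−1} d/dr∫σ_r|V|²`, a continuous function (file I). [folklore] -/
theorem continuousAt_fluxWeight (hρ : 0 < ρ)
    (hσ : IsTestFunctionOn (⊤ : Opens (EuclideanSpace ℝ (Fin 3))) σ)
    (hVm : AEStronglyMeasurable V volume)
    (hV2 : LocallyIntegrable (fun y => ‖V y‖ ^ 2) volume)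
    (hEE : ∀ L : ℝ, 0 < L → (2 - 5 * (1 / (2 + ρ))) * ∫ x, σ (L⁻¹ • x) * ‖V x‖ ^ 2 =
      (∫ x, (‖V x‖ ^ 2 + 2 * P x) * ⟪V x, gradient (fun z => σ (L⁻¹ • z)) x⟫) +
        (1 / (2 + ρ)) * ∫ x, ‖V x‖ ^ 2 * ⟪x, gradient (fun z => σ (L⁻¹ • z)) x⟫)
    {L : ℝ} (hL : 0 < L) :
    ContinuousAt (fun r : ℝ => (2 + ρ) * r ^ (2 * ρ - 2) *
      ∫ x, (‖V x‖ ^ 2 + 2 * P x) * ⟪V x, gradient (fun z => σ (r⁻¹ • z)) x⟫) L := by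
  have hσ1 : ContDiff ℝ 1 σ := hσ.contDiff.of_le (by norm_cast)
  -- the continuous expression of the scale derivative
  have hcont : ContinuousAt (fun r : ℝ => (2 * ρ - 1) * r ^ (2 * ρ - 2) * (∫ y, σ (r⁻¹ • y) * ‖V y‖ ^ 2)
      + r ^ (2 * ρ - 1) * ∫ y, (-(r ^ 2)⁻¹ * fderiv ℝ σ (r⁻¹ • y) y) * ‖V y‖ ^ 2) L := by
    have hI : ContinuousAt (fun r : ℝ => ∫ y, σ (r⁻¹ • y) * ‖V y‖ ^ 2) L :=
      (hasDerivAt_cutoffEnergy hσ1 hσ.hasCompactSupport hVm hV2 hL).2.continuousAt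
    have hI' := continuousAt_cutoffEnergyDeriv hσ1 hσ.hasCompactSupport hVm hV2 hL
    have hp1 : ContinuousAt (fun r : ℝ => r ^ (2 * ρ - 2)) L :=
      Real.continuousAt_rpow_const _ _ (Or.inl hL.ne')
    have hp2 : ContinuousAt (fun r : ℝ => r ^ (2 * ρ - 1)) L :=
      Real.continuousAt_rpow_const _ _ (Or.inl hL.ne')
    exact ((continuousAt_const.mul hp1).mul hI).add (hp2.mul hI')
  refine hcont.congr ?_
  filter_upwards [Ioi_mem_nhds hL] with r hr
  have hr0 : 0 < r := hr
  have hd1 := hasDerivAt_normEnergy_of_energyEquality hρ hσ hVm hV2 hr0 (hEE r hr0)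
  have hpow : HasDerivAt (fun L : ℝ => L ^ (2 * ρ - 1)) ((2 * ρ - 1) * r ^ (2 * ρ - 1 - 1)) r :=
    Real.hasDerivAt_rpow_const (Or.inl hr0.ne')
  have hd2 : HasDerivAt (fun L : ℝ => L ^ (2 * ρ - 1) * ∫ y, σ (L⁻¹ • y) * ‖V y‖ ^ 2)
      ((2 * ρ - 1) * r ^ (2 * ρ - 1 - 1) * (∫ y, σ (r⁻¹ • y) * ‖V y‖ ^ 2) +
        r ^ (2 * ρ - 1) * ∫ y, (-(r ^ 2)⁻¹ * fderiv ℝ σ (r⁻¹ • y) y) * ‖V y‖ ^ 2) r :=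
    hpow.mul (hasDerivAt_cutoffEnergy hσ1 hσ.hasCompactSupport hVm hV2 hr0).2
  have := hd1.unique hd2
  rw [show (2 * ρ - 1 - 1) = 2 * ρ - 2 by ring] at this
  exact this.symm

/-! ## The flux weight through the tail supremum -/

/-- Real form of a finite `ℝ≥0∞` bound on a set integral of a non-negative function:
`∫_s f ≤ (ENNReal.ofReal b).toReal = b`. [folklore] -/
theorem setIntegral_le_of_lintegral_le {f : EuclideanSpace ℝ (Fin 3) → ℝ} {s : Set (EuclideanSpace ℝ (Fin 3))}
    (hf : ∀ y, 0 ≤ f y) {b : ℝ} (hb : 0 ≤ b)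
    (h : ∫⁻ y in s, ENNReal.ofReal (f y) ≤ ENNReal.ofReal b) :
    ∫ y in s, f y ≤ b := by
  by_cases hint : IntegrableOn f s volume
  · rw [integral_eq_lintegral_of_nonneg_ae (Eventually.of_forall hf) hint.aestronglyMeasurable]
    have := ENNReal.toReal_mono ENNReal.ofReal_ne_top h
    rwa [ENNReal.toReal_ofReal hb] at this
  · rw [integral_undef hint]; exact hb

/-- **The flux weight through the tail supremum.**  Under the class data (weak gradient, `A`-growth,
`E`- and `D`-weights, `0 < ρ < 1`), the weak Poisson equation and a cut-off `σ` as in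
`exists_radialCutoff`, there is `A ≥ 0` such that: if `0 ≤ S ≤ 3c`, `L ≥ 1` and
`∫σ(R⁻¹y)|V|² ≤ R^{1−2ρ} S` for all `R ≥ L`, then for every `r ≥ L`
`|(2+ρ) r^{2ρ−2} F_σ(r)| ≤ A · S^{1/2} · r^{−1−(2+ρ)/4}`, `F_σ(r) = ∫(|V|²+2P)⟪V,∇σ_r⟫`. [folklore] -/
theorem exists_fluxWeight_le_of_sup (hρ : 0 < ρ) (hρ1 : ρ < 1)
    (hσ : IsTestFunctionOn (⊤ : Opens (EuclideanSpace ℝ (Fin 3))) σ) (h0 : ∀ z, 0 ≤ σ z)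
    (h1 : ∀ z, σ z ≤ 1) (hone : ∀ z, ‖z‖ ≤ 1 → σ z = 1) (hzero : ∀ z, 2 ≤ ‖z‖ → σ z = 0)
    (hVm : AEStronglyMeasurable V volume) (hPm : AEStronglyMeasurable P volume)
    (hGm : AEStronglyMeasurable G volume)
    (hVG : HasWeakFDerivOn (⊤ : Opens (EuclideanSpace ℝ (Fin 3))) volume V G) {c : ℝ≥0}
    (hA : ∀ L : ℝ, 0 < L → ∫⁻ y in ball (0 : EuclideanSpace ℝ (Fin 3)) L, ‖V y‖ₑ ^ 2 ≤
      (c : ℝ≥0∞) * ENNReal.ofReal (L ^ (1 - 2 * ρ)))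
    (hE : ∫⁻ y, ENNReal.ofReal (frobeniusNormSq (G y)) * ENNReal.ofReal (‖y‖ ^ (ρ - 1)) ≤
      ENNReal.ofReal ((1 - ρ) / (2 + ρ)) * (c : ℝ≥0∞))
    (hD : ∫⁻ y, ‖P y‖ₑ ^ (3 / 2 : ℝ) * ENNReal.ofReal (‖y‖ ^ (2 * ρ - 2)) ≤
      ENNReal.ofReal ((2 - 2 * ρ) / (2 + ρ)) * (c : ℝ≥0∞))
    (hPoisson : ∀ θ : EuclideanSpace ℝ (Fin 3) → ℝ, ContDiff ℝ (⊤ : ℕ∞) θ → HasCompactSupport θ →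
      ∫ y, P y * (Δ θ) y = -∫ y, fderiv ℝ (fderiv ℝ θ) y (V y) (V y)) :
    ∃ A : ℝ, 0 ≤ A ∧ ∀ S : ℝ, 0 ≤ S → S ≤ 3 * c → ∀ L : ℝ, 1 ≤ L →
      (∀ R : ℝ, L ≤ R → ∫ y, σ (R⁻¹ • y) * ‖V y‖ ^ 2 ≤ R ^ (1 - 2 * ρ) * S) →
      ∀ r : ℝ, L ≤ r →
        |(2 + ρ) * r ^ (2 * ρ - 2) *
            ∫ x, (‖V x‖ ^ 2 + 2 * P x) * ⟪V x, gradient (fun z => σ (r⁻¹ • z)) x⟫| ≤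
          A * S ^ (1 / 2 : ℝ) * r ^ (-1 - (2 + ρ) / 4) := by
  have hc0 : (0 : ℝ) ≤ c := c.2
  have hσd : Differentiable ℝ σ := hσ.contDiff.differentiable (by simp)
  obtain ⟨M, hM⟩ := (hσ.contDiff.continuous_fderiv (by simp)).bounded_above_of_compact_support
    (hσ.hasCompactSupport.fderiv (𝕜 := ℝ))
  have hM0 : 0 ≤ M := (norm_nonneg _).trans (hM 0)
  -- the constants of files IV–V
  set K₂ : ℝ := ((SNormLESNormFDerivOfEqConst (EuclideanSpace ℝ (Fin 3))
      (volume : Measure (EuclideanSpace ℝ (Fin 3))) 2 : ℝ) ^ (3 / 2 : ℝ) *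
    (2 * (3 : ℝ) ^ (1 - ρ) * ((1 - ρ) / (2 + ρ) * c) + 6 * M ^ 2 * (3 : ℝ) ^ (1 - 2 * ρ) * c) ^ (3 / 4 : ℝ) *
    (3 * c) ^ (1 / 4 : ℝ)) with hK₂
  have h1ρ : 0 ≤ (1 - ρ) / (2 + ρ) := by apply div_nonneg <;> linarith
  have hK₂0 : 0 ≤ K₂ := by positivity
  obtain ⟨K₇, hK₇0, hK₇⟩ := exists_lintegral_halfBall_pressure_velocity_le_of_sup hρ hρ1 hσ h0 h1 hone hzero
    hM hVm hPm hGm hVG hA hE hD hPoisson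
  have hloc3 := (locallyIntegrable_norm_cube hρ hρ1 hσ h0 h1 hone hzero hM hVm hGm hVG hA hE).2
  have hlocPV := (locallyIntegrable_pressure_velocity hρ hρ1 hσ h0 h1 hone hzero hM hVm hPm hGm hVG hA hE
    hD hPoisson).2
  set E : ℝ := (6 - 9 * ρ) / 4 with hEdef
  refine ⟨(2 + ρ) * M * (K₂ + 2 * K₇) * (8 : ℝ) ^ E, by positivity, ?_⟩
  intro S hS hS3 L hL hsup r hr
  have hr1 : 1 ≤ r := hL.trans hr
  have hr0 : 0 < r := lt_of_lt_of_le one_pos hr1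
  set R : ℝ := 8 * r with hRdef
  have hR1 : 1 ≤ R := by rw [hRdef]; linarith
  have hR0 : 0 < R := by positivity
  have hRL : L ≤ R := by rw [hRdef]; linarith
  have hsupR := hsup R hRL
  have hS12 : 0 ≤ S ^ (1 / 2 : ℝ) := Real.rpow_nonneg hS _
  have hRE : 0 ≤ R ^ E := Real.rpow_nonneg hR0.le _
  -- the two ball bounds at scale `R = 8r`
  have hC3 := lintegral_ball_cube_le_of_sup hρ hρ1 hσ h0 h1 hone hzero hM hVm hGm hVG hA hE hS hS3 hR1 hsupR
  rw [← hK₂] at hC3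
  have hPV := hK₇ S hS hS3 R hR1 hsupR
  -- real forms on the shell `r ≤ |y| ≤ 2r ⊆ B_{R/2} ⊆ B_R`
  set Sh : Set (EuclideanSpace ℝ (Fin 3)) := {y | r ≤ ‖y‖ ∧ ‖y‖ ≤ 2 * r} with hSh
  have hShm : MeasurableSet Sh :=
    ((isClosed_le continuous_const continuous_norm).inter (isClosed_le continuous_norm continuous_const)).measurableSet
  have hShR2 : Sh ⊆ ball (0 : EuclideanSpace ℝ (Fin 3)) (R / 2) := fun y hy => by
    rw [mem_ball, dist_zero_right, hRdef]; linarith [hy.2]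
  have hShR : Sh ⊆ ball (0 : EuclideanSpace ℝ (Fin 3)) R :=
    hShR2.trans (ball_subset_ball (by linarith))
  have hcube_real : ∫ y in Sh, ‖V y‖ ^ 3 ≤ K₂ * S ^ (1 / 2 : ℝ) * R ^ E := by
    refine setIntegral_le_of_lintegral_le (fun y => by positivity) (by positivity) ?_
    refine (lintegral_mono_set hShR).trans (le_trans (le_of_eq (lintegral_congr fun y => ?_)) hC3)
    rw [ENNReal.ofReal_pow (norm_nonneg _), ofReal_norm]
  have hPV_real : ∫ y in Sh, |P y| * ‖V y‖ ≤ K₇ * S ^ (1 / 2 : ℝ) * R ^ E := by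
    refine setIntegral_le_of_lintegral_le (fun y => by positivity) (by positivity) ?_
    refine (lintegral_mono_set hShR2).trans (le_trans (le_of_eq (lintegral_congr fun y => ?_)) hPV)
    rw [ENNReal.ofReal_mul (abs_nonneg _), ← Real.norm_eq_abs, ofReal_norm, ofReal_norm]
  -- the shell density integral
  have hX : ∫ y in Sh, (‖V y‖ ^ 3 + 2 * |P y| * ‖V y‖) ≤ (K₂ + 2 * K₇) * S ^ (1 / 2 : ℝ) * R ^ E := by
    have hi1 : IntegrableOn (fun y => ‖V y‖ ^ 3) Sh volume :=
      (hloc3.integrableOn_isCompact (isCompact_closedBall (0 : EuclideanSpace ℝ (Fin 3)) (2 * r))).mono_set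
        (fun y hy => by rw [mem_closedBall, dist_zero_right]; exact hy.2)
    have hi2 : IntegrableOn (fun y => |P y| * ‖V y‖) Sh volume :=
      (hlocPV.integrableOn_isCompact (isCompact_closedBall (0 : EuclideanSpace ℝ (Fin 3)) (2 * r))).mono_set
        (fun y hy => by rw [mem_closedBall, dist_zero_right]; exact hy.2)
    have e : ∫ y in Sh, (‖V y‖ ^ 3 + 2 * |P y| * ‖V y‖) =
        (∫ y in Sh, ‖V y‖ ^ 3) + 2 * ∫ y in Sh, |P y| * ‖V y‖ := by
      rw [← integral_const_mul, ← integral_add hi1 (hi2.const_mul 2)]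
      refine integral_congr_ae (Eventually.of_forall fun y => ?_)
      simp only; ring
    rw [e]
    nlinarith [hcube_real, hPV_real]
  -- the flux bound of file I
  have hF := abs_flux_le hσd h0 h1 hone hzero hM hloc3 hlocPV hr0
  -- assemble
  have hX0 : 0 ≤ ∫ y in Sh, (‖V y‖ ^ 3 + 2 * |P y| * ‖V y‖) :=
    setIntegral_nonneg hShm fun y _ => by positivity
  have hpow : r ^ (2 * ρ - 2) * r⁻¹ * R ^ E = (8 : ℝ) ^ E * r ^ (-1 - (2 + ρ) / 4) := by
    rw [hRdef, Real.mul_rpow (by norm_num) hr0.le, ← Real.rpow_neg_one r]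
    have : r ^ (2 * ρ - 2) * r ^ (-1 : ℝ) * r ^ E = r ^ (-1 - (2 + ρ) / 4) := by
      rw [← Real.rpow_add hr0, ← Real.rpow_add hr0, hEdef]; ring_nf
    calc r ^ (2 * ρ - 2) * r ^ (-1 : ℝ) * ((8 : ℝ) ^ E * r ^ E)
        = (8 : ℝ) ^ E * (r ^ (2 * ρ - 2) * r ^ (-1 : ℝ) * r ^ E) := by ring
      _ = _ := by rw [this]
  rw [abs_mul, abs_mul, abs_of_pos (by linarith : (0 : ℝ) < 2 + ρ),
    abs_of_nonneg (Real.rpow_nonneg hr0.le _)]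
  calc (2 + ρ) * r ^ (2 * ρ - 2) *
        |∫ x, (‖V x‖ ^ 2 + 2 * P x) * ⟪V x, gradient (fun z => σ (r⁻¹ • z)) x⟫|
      ≤ (2 + ρ) * r ^ (2 * ρ - 2) * (M / r * ∫ y in Sh, (‖V y‖ ^ 3 + 2 * |P y| * ‖V y‖)) := by
        gcongr
    _ ≤ (2 + ρ) * r ^ (2 * ρ - 2) * (M / r * ((K₂ + 2 * K₇) * S ^ (1 / 2 : ℝ) * R ^ E)) := by
        gcongr
    _ = (2 + ρ) * M * (K₂ + 2 * K₇) * S ^ (1 / 2 : ℝ) * (r ^ (2 * ρ - 2) * r⁻¹ * R ^ E) := by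
        rw [div_eq_mul_inv]; ring
    _ = (2 + ρ) * M * (K₂ + 2 * K₇) * (8 : ℝ) ^ E * S ^ (1 / 2 : ℝ) * r ^ (-1 - (2 + ρ) / 4) := by
        rw [hpow]; ring

/-! ## The tail estimate -/

/-- **The tail estimate for the normalised energy.**  If the flux weight obeys
`|(2+ρ) r^{2ρ−2} F_σ(r)| ≤ B r^{−1−a}` on `[L, ∞)` (`a > 0`, `L > 0`) and the scale identity of file II
holds, then `|N_σ(L₂) − N_σ(L₁)| ≤ (B/a) L₁^{−a}` for `L ≤ L₁ ≤ L₂`. [folklore] -/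
theorem abs_normEnergy_sub_le_of_fluxWeight_le (hρ : 0 < ρ)
    (hσ : IsTestFunctionOn (⊤ : Opens (EuclideanSpace ℝ (Fin 3))) σ)
    (hVm : AEStronglyMeasurable V volume)
    (hV2 : LocallyIntegrable (fun y => ‖V y‖ ^ 2) volume)
    (hEE : ∀ L : ℝ, 0 < L → (2 - 5 * (1 / (2 + ρ))) * ∫ x, σ (L⁻¹ • x) * ‖V x‖ ^ 2 =
      (∫ x, (‖V x‖ ^ 2 + 2 * P x) * ⟪V x, gradient (fun z => σ (L⁻¹ • z)) x⟫) +
        (1 / (2 + ρ)) * ∫ x, ‖V x‖ ^ 2 * ⟪x, gradient (fun z => σ (L⁻¹ • z)) x⟫)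
    {B a L : ℝ} (hB : 0 ≤ B) (ha : 0 < a) (hL : 0 < L)
    (hflux : ∀ r : ℝ, L ≤ r → |(2 + ρ) * r ^ (2 * ρ - 2) *
        ∫ x, (‖V x‖ ^ 2 + 2 * P x) * ⟪V x, gradient (fun z => σ (r⁻¹ • z)) x⟫| ≤ B * r ^ (-1 - a))
    {L₁ L₂ : ℝ} (hL₁ : L ≤ L₁) (h12 : L₁ ≤ L₂) :
    |L₂ ^ (2 * ρ - 1) * (∫ y, σ (L₂⁻¹ • y) * ‖V y‖ ^ 2) -
        L₁ ^ (2 * ρ - 1) * (∫ y, σ (L₁⁻¹ • y) * ‖V y‖ ^ 2)| ≤ B / a * L₁ ^ (-a) := by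
  have hL₁0 : 0 < L₁ := lt_of_lt_of_le hL hL₁
  have hL₂0 : 0 < L₂ := lt_of_lt_of_le hL₁0 h12
  rw [normEnergy_sub_eq_integral_flux hρ hσ hVm hV2 hEE hL₁0 h12]
  -- dominate the integrand by `B r^{-1-a}` on `[L₁, L₂]`
  have hgint : IntervalIntegrable (fun r : ℝ => B * r ^ (-1 - a)) volume L₁ L₂ := by
    refine (ContinuousOn.intervalIntegrable_of_Icc h12 ?_)
    exact continuousOn_const.mul (fun r hr =>
      (Real.continuousAt_rpow_const _ _ (Or.inl (lt_of_lt_of_le hL₁0 hr.1).ne')).continuousWithinAt)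
  have hle := intervalIntegral.norm_integral_le_of_norm_le h12
    (f := fun r : ℝ => (2 + ρ) * r ^ (2 * ρ - 2) *
      ∫ x, (‖V x‖ ^ 2 + 2 * P x) * ⟪V x, gradient (fun z => σ (r⁻¹ • z)) x⟫)
    (Eventually.of_forall fun r hr => by
      rw [Real.norm_eq_abs]; exact hflux r (hL₁.trans hr.1.le)) hgint
  rw [Real.norm_eq_abs] at hle
  refine hle.trans ?_
  -- `∫_{L₁}^{L₂} B r^{-1-a} = B (L₁^{-a} − L₂^{-a}) / a ≤ (B/a) L₁^{-a}`
  have h0notin : (0 : ℝ) ∉ uIcc L₁ L₂ := by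
    rw [uIcc_of_le h12]; exact fun h => (lt_irrefl _ (lt_of_lt_of_le hL₁0 h.1)).elim
  rw [intervalIntegral.integral_const_mul, integral_rpow (Or.inr ⟨by linarith, h0notin⟩)]
  rw [show -1 - a + 1 = -a by ring]
  have hL₂a : 0 ≤ L₂ ^ (-a) := Real.rpow_nonneg hL₂0.le _
  have hL₁a : 0 ≤ L₁ ^ (-a) := Real.rpow_nonneg hL₁0.le _
  rw [div_eq_mul_inv, div_eq_mul_inv]
  have hna : (-a)⁻¹ = -a⁻¹ := by rw [inv_neg]
  rw [hna]
  have ha' : 0 < a⁻¹ := inv_pos.2 ha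
  nlinarith [mul_nonneg hB hL₂a, mul_nonneg hB hL₁a]

end EnergySaturation

end Summit.NavierStokesRegularity.NavierStokesRegularity.Theorems.PowerGaugeEulerLiouville

end
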